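import Summits.Ventures.PercRepro2.CaseOneRootsAndOI

/-!
# The D-world `(i)` at the PD pair is free of the root edges at `a₃` (blind cell PercRepro2, p1 g19;
S5 §2.1 (K9): the `(i)` twin of identity (E), for EVERY `a₃`)

Identity (E) for `(i)` holds for every `a₃` (`iExprD_a1_edge_pull`; `p₀ = p[e₁ ↦ 0]`, `p₁ = p(e₁)`,
`Y = {b ∈ C₁} ∪ {b ↔ a₃}` the pull-back of `{b ∈ C₁}` under the opening of `e₁`):

  `iExprD p = (1 − p₁) iExprD p₀ + p₁ c₁ [P₀(D, Y) P₀(D, o ∈ C₂) − P₀(D) P₀(D, Y, o ∈ C₂)]`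
  `  + p₁ (1 − p₁) (P₀(D, Y) − P₀(D, b ∈ C₁)) ·`
  `      [c₀ (P₀(D) − P₀(D, a₃ ∈ C₁)) − c₁ (P₀(D, o ∈ C₂) − P₀(D, a₃ ∈ C₁, o ∈ C₂))]`.

The first bracket is `≥ 0` (`covDwIY_nonpos`: `Y ∩ D` is the event `C(b) ∋ a₁ or a₃` off the
cluster of `a₂`, negatively correlated with `{o ∈ C₂}` under `a₂ ↮ {a₁, a₃}` —
`bhk_cross_cluster_avoid` with `a₂ ↮ {a₁, a₃, b}` and `bhk_same_cluster_events_avoid` to pass from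
`{a₁, a₃, b}` to `{a₁, a₃}`), and at the PD pair of `p₀` the last bracket is
`P₀(PD) · [P₀(PD, o ∈ U) − P₀(PD, o ∈ C₂)] ≥ 0` (`D ∖ A = PD`).
Hence **`zSplitID_of_a1_edge`** (every `a₁a₃`-edge, every graph), and with `zSplitID_of_a2_edge`
the reduction **`zSplitID_of_rootFree`** / **`zSplitI_of_rootFree`**: `(i)` for `G` follows from the
D-world `(i)` at the PD pair of the weight vector with EVERY root edge at `a₃` null — the root edges
at `a₃` are irrelevant to `(i)` in the D-world, as they are to `(ii)` (`zSplitIID_of_rootFree`). Own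
code; standard axioms.
-/

namespace Summit.Ventures.PercRepro2

namespace CaseOne

/-! ## The pulled-back `b`-event is an outside event -/

section Sets
variable {V : Type*} {E : Type*} [DecidableEq V]

/-- `{b ∈ C₁ ∨ b ↔ a₃} ∩ D = {C(b) ∋ a₁ ∨ a₃} ∩ {a₂ ↮ {a₁, a₃, b}}`. -/
lemma Y_inter_Dw_eq (ends : E → Sym2 V) (a₁ a₂ a₃ b : V) :
    (connEvent ends a₁ b ∪ connEvent ends a₃ b) ∩ Dw ends a₁ a₂ a₃ =
      clusterInEvent ends b {W : Set V | a₁ ∈ W ∨ a₃ ∈ W} ∩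
        avoidAll ends a₂ ({a₁, a₃, b} : Finset V) := by
  ext ω
  simp only [Dw, Set.mem_inter_iff, Set.mem_union, Set.mem_compl_iff, mem_connEvent,
    mem_clusterInEvent, mem_cluster, Set.mem_setOf_eq, mem_avoidAll, Finset.mem_insert,
    Finset.mem_singleton, forall_eq_or_imp, forall_eq]
  constructor
  · rintro ⟨h | h, h12, h23⟩
    · exact ⟨Or.inl (conn_symm h), fun h' => h12 (conn_symm h'), h23,
        fun h2b => h12 (conn_symm (conn_trans h2b (conn_symm h)))⟩
    · exact ⟨Or.inr (conn_symm h), fun h' => h12 (conn_symm h'), h23,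
        fun h2b => h23 (conn_trans h2b (conn_symm h))⟩
  · rintro ⟨h | h, h21, h23, _⟩
    · exact ⟨Or.inl (conn_symm h), fun h' => h21 (conn_symm h'), h23⟩
    · exact ⟨Or.inr (conn_symm h), fun h' => h21 (conn_symm h'), h23⟩

/-- The same with `{o ∈ C₂}`. -/
lemma YO_inter_Dw_eq (ends : E → Sym2 V) (o a₁ a₂ a₃ b : V) :
    (connEvent ends a₁ b ∪ connEvent ends a₃ b) ∩ connEvent ends a₂ o ∩ Dw ends a₁ a₂ a₃ =
      connEvent ends a₂ o ∩ clusterInEvent ends b {W : Set V | a₁ ∈ W ∨ a₃ ∈ W} ∩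
        avoidAll ends a₂ ({a₁, a₃, b} : Finset V) := by
  have e := Y_inter_Dw_eq ends a₁ a₂ a₃ b
  ext ω
  constructor
  · rintro ⟨⟨hY, hO⟩, hD⟩
    have := (Set.ext_iff.1 e ω).1 ⟨hY, hD⟩
    exact ⟨⟨hO, this.1⟩, this.2⟩
  · rintro ⟨⟨hO, hY⟩, hav⟩
    have := (Set.ext_iff.1 e ω).2 ⟨hY, hav⟩
    exact ⟨⟨this.1, hO⟩, this.2⟩

/-- `{a₂ ↮ {a₁, a₃, b}} = D ∩ {b ∉ C₂}`. -/
lemma avoidAll_three_eq (ends : E → Sym2 V) (a₁ a₂ a₃ b : V) :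
    avoidAll ends a₂ ({a₁, a₃, b} : Finset V) = Dw ends a₁ a₂ a₃ ∩ (connEvent ends a₂ b)ᶜ := by
  ext ω
  simp only [Dw, Set.mem_inter_iff, Set.mem_compl_iff, mem_connEvent, mem_avoidAll,
    Finset.mem_insert, Finset.mem_singleton, forall_eq_or_imp, forall_eq]
  constructor
  · rintro ⟨h1, h2, h3⟩
    exact ⟨⟨fun h => h1 (conn_symm h), h2⟩, h3⟩
  · rintro ⟨⟨h1, h2⟩, h3⟩
    exact ⟨fun h => h1 (conn_symm h), h2, h3⟩

omit [DecidableEq V] in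
/-- `D ∖ {a₃ ∈ C₁}` is the PD event. -/
lemma Dw_inter_compl_A (ends : E → Sym2 V) (a₁ a₂ a₃ : V) :
    Dw ends a₁ a₂ a₃ ∩ (connEvent ends a₁ a₃)ᶜ =
      (connEvent ends a₁ a₃)ᶜ ∩ (connEvent ends a₂ a₃)ᶜ ∩ (connEvent ends a₁ a₂)ᶜ := by
  ext ω; simp only [Dw, Set.mem_inter_iff, Set.mem_compl_iff]; tauto

end Sets

section Outside
variable {V : Type*} {E : Type*} [Fintype E] [DecidableEq E] [Fintype V] [DecidableEq V]
  {R : Type*} [Field R] [LinearOrder R] [IsStrictOrderedRing R]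

/-- **The pulled-back `b`-event against `{o ∈ C₂}` in the D-world** (BHK 1.4 with the outside
event `C(b) ∋ a₁ ∨ a₃`): `P(D) P(D, Y, o ∈ C₂) ≤ P(D, Y) P(D, o ∈ C₂)`. -/
theorem covDwIY_nonpos (p : E → R) (hp : IsProbVec p) (ends : E → Sym2 V) (o a₁ a₂ a₃ b : V) :
    prob p (Dw ends a₁ a₂ a₃) *
        prob p ((connEvent ends a₁ b ∪ connEvent ends a₃ b) ∩ connEvent ends a₂ o ∩
          Dw ends a₁ a₂ a₃) ≤
      prob p ((connEvent ends a₁ b ∪ connEvent ends a₃ b) ∩ Dw ends a₁ a₂ a₃) *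
        prob p (connEvent ends a₂ o ∩ Dw ends a₁ a₂ a₃) := by
  have h𝓥 : IsUpperSet {W : Set V | a₁ ∈ W ∨ a₃ ∈ W} := fun _ _ h hW => hW.imp (h ·) (h ·)
  have h1 := bhk_cross_cluster_avoid p hp ends a₂ b (X := ({a₁, a₃, b} : Finset V)) (by simp)
    (isUpperSet_mem_setOf o) h𝓥
  have h2 := bhk_same_cluster_events_avoid p hp ends a₂ ({a₁, a₃} : Finset V)
    (isUpperSet_mem_setOf o) (isUpperSet_mem_setOf b)
  have e3 : clusterInEvent ends a₂ ({W : Set V | o ∈ W} ∩ {W | b ∈ W}) =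
      connEvent ends a₂ o ∩ connEvent ends a₂ b := by
    ext ω; simp [clusterInEvent, connEvent_eq_clusterInEvent]
  rw [e3, ← connEvent_eq_clusterInEvent ends a₂ o, ← connEvent_eq_clusterInEvent ends a₂ b,
    ← Dw_eq_avoidAll] at h2
  rw [← connEvent_eq_clusterInEvent ends a₂ o] at h1
  rw [← YO_inter_Dw_eq, ← Y_inter_Dw_eq, avoidAll_three_eq] at h1
  -- the masses of `D′ = D ∩ {b ∉ C₂}`
  have hd' := prob_inter_add_prob_inter_compl p (Dw ends a₁ a₂ a₃) (connEvent ends a₂ b)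
  have hO' := prob_inter_add_prob_inter_compl p (connEvent ends a₂ o ∩ Dw ends a₁ a₂ a₃)
    (connEvent ends a₂ b)
  have e4 : connEvent ends a₂ o ∩ Dw ends a₁ a₂ a₃ ∩ (connEvent ends a₂ b)ᶜ =
      connEvent ends a₂ o ∩ (Dw ends a₁ a₂ a₃ ∩ (connEvent ends a₂ b)ᶜ) := by
    rw [Set.inter_assoc]
  have e5 : connEvent ends a₂ o ∩ Dw ends a₁ a₂ a₃ ∩ connEvent ends a₂ b =
      connEvent ends a₂ o ∩ connEvent ends a₂ b ∩ Dw ends a₁ a₂ a₃ := by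
    ext ω; simp only [Set.mem_inter_iff]; tauto
  have e6 : Dw ends a₁ a₂ a₃ ∩ connEvent ends a₂ b = connEvent ends a₂ b ∩ Dw ends a₁ a₂ a₃ :=
    Set.inter_comm _ _
  rw [e4, e5] at hO'
  rw [e6] at hd'
  set d := prob p (Dw ends a₁ a₂ a₃)
  set d' := prob p (Dw ends a₁ a₂ a₃ ∩ (connEvent ends a₂ b)ᶜ)
  set dO := prob p (connEvent ends a₂ o ∩ Dw ends a₁ a₂ a₃)
  set dO' := prob p (connEvent ends a₂ o ∩ (Dw ends a₁ a₂ a₃ ∩ (connEvent ends a₂ b)ᶜ))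
  set dB := prob p (connEvent ends a₂ b ∩ Dw ends a₁ a₂ a₃)
  set dOB := prob p (connEvent ends a₂ o ∩ connEvent ends a₂ b ∩ Dw ends a₁ a₂ a₃)
  set y := prob p ((connEvent ends a₁ b ∪ connEvent ends a₃ b) ∩ Dw ends a₁ a₂ a₃)
  set yo := prob p ((connEvent ends a₁ b ∪ connEvent ends a₃ b) ∩ connEvent ends a₂ o ∩
    Dw ends a₁ a₂ a₃)
  -- `dO′ · d ≤ dO · d′` from `h2`, then combine with `h1 : yo · d′ ≤ dO′ · y`
  have hdB : dB = d - d' := by linarith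
  have hdOB : dOB = dO - dO' := by linarith
  rw [hdB, hdOB] at h2
  have hk : dO' * d ≤ dO * d' := by linarith [h2]
  have hy0 : 0 ≤ y := prob_nonneg hp _
  have hd0 : 0 ≤ d := prob_nonneg hp _
  have hd'0 : 0 ≤ d' := prob_nonneg hp _
  have hyo0 : 0 ≤ yo := prob_nonneg hp _
  rcases hd'0.lt_or_eq with hpos | hzero
  · have s1 : yo * d' * d ≤ dO' * y * d := mul_le_mul_of_nonneg_right h1 hd0
    have s2 : dO' * d * y ≤ dO * d' * y := mul_le_mul_of_nonneg_right hk hy0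
    have : (d * yo) * d' ≤ (y * dO) * d' := by nlinarith [s1, s2]
    exact le_of_mul_le_mul_right this hpos
  · -- `P(D′) = 0` forces `y = yo = 0`
    have hy : y = 0 := by
      have hsub : (connEvent ends a₁ b ∪ connEvent ends a₃ b) ∩ Dw ends a₁ a₂ a₃ ⊆
          Dw ends a₁ a₂ a₃ ∩ (connEvent ends a₂ b)ᶜ := by
        rw [Y_inter_Dw_eq, avoidAll_three_eq]
        exact Set.inter_subset_right
      exact le_antisymm (hzero ▸ prob_mono hp hsub) hy0
    have hyo : yo = 0 := by
      have hsub : (connEvent ends a₁ b ∪ connEvent ends a₃ b) ∩ connEvent ends a₂ o ∩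
          Dw ends a₁ a₂ a₃ ⊆ Dw ends a₁ a₂ a₃ ∩ (connEvent ends a₂ b)ᶜ := by
        rw [YO_inter_Dw_eq, avoidAll_three_eq]
        exact Set.inter_subset_right
      exact le_antisymm (hzero ▸ prob_mono hp hsub) hyo0
    rw [hy, hyo]
    simp

end Outside

/-! ## Identity (E) for `(i)`, every `a₃` -/

section IdentityE
variable {V : Type*} {E : Type*} [Fintype E] [DecidableEq E] {R : Type*} [CommRing R]
variable {ends : E → Sym2 V} {a₁ a₂ a₃ : V} {e₁ : E}

/-- **Identity (E) for `(i)`, every `a₃`**: pinning an `a₁a₃`-edge (the identity of the module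
docstring; `p₀ = p[e₁ ↦ 0]`, `Y = {b ∈ C₁} ∪ {b ↔ a₃}`). -/
theorem iExprD_a1_edge_pull (p : E → R) (he : ends e₁ = s(a₁, a₃)) (o b : V) (c₀ c₁ : R) :
    iExprD p ends o a₁ a₂ a₃ b c₀ c₁ =
      (1 - p e₁) * iExprD (Function.update p e₁ 0) ends o a₁ a₂ a₃ b c₀ c₁ +
      p e₁ * c₁ * (prob (Function.update p e₁ 0) ((connEvent ends a₁ b ∪ connEvent ends a₃ b) ∩
            Dw ends a₁ a₂ a₃) *
          prob (Function.update p e₁ 0) (connEvent ends a₂ o ∩ Dw ends a₁ a₂ a₃) -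
        prob (Function.update p e₁ 0) (Dw ends a₁ a₂ a₃) *
          prob (Function.update p e₁ 0) ((connEvent ends a₁ b ∪ connEvent ends a₃ b) ∩
            connEvent ends a₂ o ∩ Dw ends a₁ a₂ a₃)) +
      p e₁ * (1 - p e₁) *
        (prob (Function.update p e₁ 0) ((connEvent ends a₁ b ∪ connEvent ends a₃ b) ∩
            Dw ends a₁ a₂ a₃) -
          prob (Function.update p e₁ 0) (connEvent ends a₁ b ∩ Dw ends a₁ a₂ a₃)) *
        (c₀ * (prob (Function.update p e₁ 0) (Dw ends a₁ a₂ a₃) -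
            prob (Function.update p e₁ 0) (connEvent ends a₁ a₃ ∩ Dw ends a₁ a₂ a₃)) -
          c₁ * (prob (Function.update p e₁ 0) (connEvent ends a₂ o ∩ Dw ends a₁ a₂ a₃) -
            prob (Function.update p e₁ 0) (connEvent ends a₂ o ∩ connEvent ends a₁ a₃ ∩
              Dw ends a₁ a₂ a₃))) := by
  rw [iExprD_eq, iExprD_eq]
  rw [← B₁AO_inter_Dw, ← AO_inter_Dw, ← B₁A_inter_Dw, ← A_inter_Dw]
  have hB := b1_event_update_pull (a₂ := a₂) he b
  have hO := a2_event_update (a₂ := a₂) he o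
  have hBO := inter_event_update_pull hB hO
  have hU := univ_event_update (ends := ends) (a₁ := a₁) (a₂ := a₂) (a₃ := a₃) (e₁ := e₁)
  have hd : prob p (Dw ends a₁ a₂ a₃) = prob (Function.update p e₁ 0) (Dw ends a₁ a₂ a₃) := by
    have := prob_inter_Dw_update p he Set.univ hU 0
    rw [Set.univ_inter] at this
    exact this.symm
  have hdB := prob_inter_Dw_pin_pull p he _ _ hB
  have e1 : connEvent ends a₁ b ∩ connEvent ends a₁ a₃ ∩ connEvent ends a₂ o ∩ Dw ends a₁ a₂ a₃ =
      (connEvent ends a₁ b ∩ connEvent ends a₂ o) ∩ connEvent ends a₁ a₃ ∩ Dw ends a₁ a₂ a₃ := by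
    ext ω; simp only [Set.mem_inter_iff]; tauto
  have e2 : connEvent ends a₁ a₃ ∩ connEvent ends a₂ o ∩ Dw ends a₁ a₂ a₃ =
      connEvent ends a₂ o ∩ connEvent ends a₁ a₃ ∩ Dw ends a₁ a₂ a₃ := by
    ext ω; simp only [Set.mem_inter_iff]; tauto
  have hBAO := prob_A_inter_Dw_pin_pull p he _ _ hBO
  have hAO := prob_A_inter_Dw_pin p he _ hO
  have hBA := prob_A_inter_Dw_pin_pull p he _ _ hB
  have hA := prob_A_inter_Dw_pin p he _ hU
  rw [Set.univ_inter, Set.univ_inter] at hA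
  rw [e1, e2, hBAO, hAO, hBA, hA, hd, hdB]
  ring

end IdentityE

/-! ## The lift along an `a₁a₃`-edge at the PD pair, every `a₃` -/

section Lift
variable {V : Type*} {E : Type*} [Fintype E] [DecidableEq E] [Fintype V] [DecidableEq V]
  {R : Type*} [Field R] [LinearOrder R] [IsStrictOrderedRing R]
variable {ends : E → Sym2 V} {a₁ a₂ a₃ : V}

/-- **`ZSplitID` lifts along EVERY `a₁a₃`-edge.** -/
theorem zSplitID_of_a1_edge (p : E → R) (hp : IsProbVec p) {e₁ : E} (he : ends e₁ = s(a₁, a₃))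
    (o b : V) (h : ZSplitID (Function.update p e₁ 0) ends o a₁ a₂ a₃ b) :
    ZSplitID p ends o a₁ a₂ a₃ b := by
  unfold ZSplitID at h ⊢
  rw [iExprD_a1_edge_pull p he o b, Dpd_a1_edge p he, Dpdo_a1_edge p he o, iExprD_smul]
  set p₀ := Function.update p e₁ 0 with hp₀
  have hp0 : IsProbVec p₀ := hp.update e₁ le_rfl zero_le_one
  have hcov := covDwIY_nonpos p₀ hp0 ends o a₁ a₂ a₃ b
  have h1 : 0 ≤ p e₁ := hp.nonneg e₁
  have h2 : 0 ≤ 1 - p e₁ := by linarith [hp.le_one e₁]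
  have hD : 0 ≤ Dpd p₀ ends a₁ a₂ a₃ := prob_nonneg hp0 _
  have hY : prob p₀ (connEvent ends a₁ b ∩ Dw ends a₁ a₂ a₃) ≤
      prob p₀ ((connEvent ends a₁ b ∪ connEvent ends a₃ b) ∩ Dw ends a₁ a₂ a₃) :=
    prob_mono hp0 (Set.inter_subset_inter_left _ Set.subset_union_left)
  -- `P₀(D) − P₀(D, a₃ ∈ C₁) = P₀(PD)` and `P₀(D, o ∈ C₂) − P₀(D, a₃ ∈ C₁, o ∈ C₂) = P₀(PD, o ∈ C₂)`
  have hdA : prob p₀ (Dw ends a₁ a₂ a₃) - prob p₀ (connEvent ends a₁ a₃ ∩ Dw ends a₁ a₂ a₃) =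
      Dpd p₀ ends a₁ a₂ a₃ := by
    have := prob_inter_add_prob_inter_compl p₀ (Dw ends a₁ a₂ a₃) (connEvent ends a₁ a₃)
    rw [Set.inter_comm, Dw_inter_compl_A] at this
    unfold Dpd
    linarith
  have hOA : prob p₀ (connEvent ends a₂ o ∩ Dw ends a₁ a₂ a₃) -
      prob p₀ (connEvent ends a₂ o ∩ connEvent ends a₁ a₃ ∩ Dw ends a₁ a₂ a₃) =
      prob p₀ (connEvent ends a₂ o ∩ ((connEvent ends a₁ a₃)ᶜ ∩ (connEvent ends a₂ a₃)ᶜ ∩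
        (connEvent ends a₁ a₂)ᶜ)) := by
    have := prob_inter_add_prob_inter_compl p₀ (connEvent ends a₂ o ∩ Dw ends a₁ a₂ a₃)
      (connEvent ends a₁ a₃)
    have e1 : connEvent ends a₂ o ∩ Dw ends a₁ a₂ a₃ ∩ connEvent ends a₁ a₃ =
        connEvent ends a₂ o ∩ connEvent ends a₁ a₃ ∩ Dw ends a₁ a₂ a₃ := by
      ext ω; simp only [Set.mem_inter_iff]; tauto
    have e2 : connEvent ends a₂ o ∩ Dw ends a₁ a₂ a₃ ∩ (connEvent ends a₁ a₃)ᶜ =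
        connEvent ends a₂ o ∩ ((connEvent ends a₁ a₃)ᶜ ∩ (connEvent ends a₂ a₃)ᶜ ∩
          (connEvent ends a₁ a₂)ᶜ) := by
      rw [Set.inter_assoc, Dw_inter_compl_A]
    rw [e1, e2] at this
    linarith
  have hle : prob p₀ (connEvent ends a₂ o ∩ ((connEvent ends a₁ a₃)ᶜ ∩ (connEvent ends a₂ a₃)ᶜ ∩
      (connEvent ends a₁ a₂)ᶜ)) ≤ Dpdo p₀ ends o a₁ a₂ a₃ := by
    unfold Dpdo
    refine prob_mono hp0 fun ω h => ?_
    exact ⟨⟨⟨Or.inr h.1, h.2.1.1⟩, h.2.1.2⟩, h.2.2⟩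
  rw [hdA, hOA]
  have t1 := mul_nonneg (mul_nonneg h1 (mul_nonneg h2 hD)) (sub_nonneg.2 hcov)
  have t2 := mul_nonneg h2 (mul_nonneg h2 h)
  have hbr : 0 ≤ (1 - p e₁) * Dpdo p₀ ends o a₁ a₂ a₃ * Dpd p₀ ends a₁ a₂ a₃ -
      (1 - p e₁) * Dpd p₀ ends a₁ a₂ a₃ *
        prob p₀ (connEvent ends a₂ o ∩ ((connEvent ends a₁ a₃)ᶜ ∩ (connEvent ends a₂ a₃)ᶜ ∩
          (connEvent ends a₁ a₂)ᶜ)) := by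
    have := mul_nonneg (mul_nonneg h2 hD) (sub_nonneg.2 hle)
    linarith [this]
  have t3 := mul_nonneg (mul_nonneg (mul_nonneg h1 h2) (sub_nonneg.2 hY)) hbr
  linarith [t1, t2, t3]

end Lift

/-! ## The root edges at `a₃` are irrelevant in the D-world -/

section RootFree
variable {V : Type*} {E : Type*} [Fintype E] [DecidableEq E] [Fintype V] [DecidableEq V]
  {R : Type*} [Field R] [LinearOrder R] [IsStrictOrderedRing R]
variable {ends : E → Sym2 V} {a₁ a₂ a₃ : V}

omit [Fintype V] [IsStrictOrderedRing R] in
/-- Pinning a live root edge removes it from the live root set. -/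
lemma filter_liveRoot_update (p : E → R) (ends : E → Sym2 V) (a₁ a₂ a₃ : V) (e : E) :
    (Finset.univ.filter fun e' => (ends e' = s(a₁, a₃) ∨ ends e' = s(a₂, a₃)) ∧
        Function.update p e 0 e' ≠ 0) =
      (Finset.univ.filter fun e' => (ends e' = s(a₁, a₃) ∨ ends e' = s(a₂, a₃)) ∧ p e' ≠ 0).erase
        e := by
  ext e'
  simp only [Finset.mem_filter, Finset.mem_univ, true_and, Finset.mem_erase, ne_eq]
  by_cases h : e' = e
  · subst h; simp
  · rw [Function.update_of_ne h]; tauto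

/-- **The D-world `(i)` at the PD pair is free of the root edges at `a₃`**: `ZSplitID` holds as soon
as it holds for every admissible weight vector with all root edges at `a₃` null. -/
theorem zSplitID_of_rootFree (p : E → R) (hp : IsProbVec p) (o b : V)
    (base : ∀ p' : E → R, IsProbVec p' →
      (∀ e, ends e = s(a₁, a₃) ∨ ends e = s(a₂, a₃) → p' e = 0) → ZSplitID p' ends o a₁ a₂ a₃ b) :
    ZSplitID p ends o a₁ a₂ a₃ b := by
  generalize hn : (Finset.univ.filter fun e' => (ends e' = s(a₁, a₃) ∨ ends e' = s(a₂, a₃)) ∧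
    p e' ≠ 0).card = n
  induction n using Nat.strong_induction_on generalizing p with
  | _ n ih =>
    by_cases h0 : (Finset.univ.filter fun e' => (ends e' = s(a₁, a₃) ∨ ends e' = s(a₂, a₃)) ∧
        p e' ≠ 0) = ∅
    · refine base p hp fun e he => ?_
      by_contra hc
      have : e ∈ (Finset.univ.filter fun e' => (ends e' = s(a₁, a₃) ∨ ends e' = s(a₂, a₃)) ∧
          p e' ≠ 0) := by simp [he, hc]
      rw [h0] at this
      exact absurd this (Finset.notMem_empty e)
    · obtain ⟨e, he⟩ := Finset.nonempty_iff_ne_empty.mpr h0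
      have he' : ends e = s(a₁, a₃) ∨ ends e = s(a₂, a₃) := by
        have := he
        simp only [Finset.mem_filter, Finset.mem_univ, true_and] at this
        exact this.1
      have hlt : ((Finset.univ.filter fun e' => (ends e' = s(a₁, a₃) ∨ ends e' = s(a₂, a₃)) ∧
          p e' ≠ 0).erase e).card < n := by
        rw [← hn]; exact Finset.card_erase_lt_of_mem he
      have hp0 : IsProbVec (Function.update p e 0) := hp.update e le_rfl zero_le_one
      have hrec := ih _ hlt (Function.update p e 0) hp0 (by rw [filter_liveRoot_update])
      rcases he' with h | h
      · exact zSplitID_of_a1_edge p hp h o b hrec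
      · exact zSplitID_of_a2_edge p hp h o b hrec

/-- **The D-world `(ii)` at the PD pair is free of the root edges at `a₃`** (the same induction on
`zSplitIID_of_a1_edge` / `zSplitIID_of_a2_edge`). -/
theorem zSplitIID_of_rootFree (p : E → R) (hp : IsProbVec p) (o b : V)
    (base : ∀ p' : E → R, IsProbVec p' →
      (∀ e, ends e = s(a₁, a₃) ∨ ends e = s(a₂, a₃) → p' e = 0) → ZSplitIID p' ends o a₁ a₂ a₃ b) :
    ZSplitIID p ends o a₁ a₂ a₃ b := by
  generalize hn : (Finset.univ.filter fun e' => (ends e' = s(a₁, a₃) ∨ ends e' = s(a₂, a₃)) ∧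
    p e' ≠ 0).card = n
  induction n using Nat.strong_induction_on generalizing p with
  | _ n ih =>
    by_cases h0 : (Finset.univ.filter fun e' => (ends e' = s(a₁, a₃) ∨ ends e' = s(a₂, a₃)) ∧
        p e' ≠ 0) = ∅
    · refine base p hp fun e he => ?_
      by_contra hc
      have : e ∈ (Finset.univ.filter fun e' => (ends e' = s(a₁, a₃) ∨ ends e' = s(a₂, a₃)) ∧
          p e' ≠ 0) := by simp [he, hc]
      rw [h0] at this
      exact absurd this (Finset.notMem_empty e)
    · obtain ⟨e, he⟩ := Finset.nonempty_iff_ne_empty.mpr h0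
      have he' : ends e = s(a₁, a₃) ∨ ends e = s(a₂, a₃) := by
        have := he
        simp only [Finset.mem_filter, Finset.mem_univ, true_and] at this
        exact this.1
      have hlt : ((Finset.univ.filter fun e' => (ends e' = s(a₁, a₃) ∨ ends e' = s(a₂, a₃)) ∧
          p e' ≠ 0).erase e).card < n := by
        rw [← hn]; exact Finset.card_erase_lt_of_mem he
      have hp0 : IsProbVec (Function.update p e 0) := hp.update e le_rfl zero_le_one
      have hrec := ih _ hlt (Function.update p e 0) hp0 (by rw [filter_liveRoot_update])
      rcases he' with h | h
      · exact zSplitIID_of_a1_edge p hp h o b hrec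
      · exact zSplitIID_of_a2_edge p hp h o b hrec

/-- **`(i)` is free of the root edges at `a₃`, through the D-world**: `(i)` for `G` follows from
the D-world `(i)` at the PD pair of every admissible weight vector with all root edges at `a₃`
null. -/
theorem zSplitI_of_rootFree (p : E → R) (hp : IsProbVec p) (o b : V)
    (base : ∀ p' : E → R, IsProbVec p' →
      (∀ e, ends e = s(a₁, a₃) ∨ ends e = s(a₂, a₃) → p' e = 0) → ZSplitID p' ends o a₁ a₂ a₃ b) :
    ZSplitI p ends o a₁ a₂ a₃ b :=
  zSplitI_of_dworld p hp ends o a₁ a₂ a₃ b (zSplitID_of_rootFree p hp o b base)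

/-- **`(ii)` is free of the root edges at `a₃`, through the D-world.** -/
theorem zSplitII_of_rootFree (p : E → R) (hp : IsProbVec p) (o b : V)
    (base : ∀ p' : E → R, IsProbVec p' →
      (∀ e, ends e = s(a₁, a₃) ∨ ends e = s(a₂, a₃) → p' e = 0) → ZSplitIID p' ends o a₁ a₂ a₃ b) :
    ZSplitII p ends o a₁ a₂ a₃ b :=
  zSplitII_of_dworld p hp ends o a₁ a₂ a₃ b (zSplitIID_of_rootFree p hp o b base)

end RootFree

end CaseOne

end Summit.Ventures.PercRepro2
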